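import Mathlib
import Summits.NavierStokesRegularity.NavierStokesRegularity.Theorems.FilamentSkeletonRssStadiumTentRealTrace

/-!
# Route `FilamentSkeletonRss` · cruxes `SkeletonJ1L` (stmt-NavierStokesRegularity-23296, registered stub `stub_tangentSkeletonL` ≡
# `TangentSkeletonNearStraightL`, stmt-23320) · line `child_tangent_analytic_strip_L` (b0b56c52900dd90a), stub `stub_stripPropagation` —
# assembly for `rcore`: THE REAL TRACE OF THE SYMMETRIC QUARTER-WIDTH TENT FIELD

At a REAL target `t` (`|t − cc| < L + hs/2`) the symmetric tent `t − hs/2 → t − hs/5 → t → t + hs/5 → t + hs/2` (vertex map `V` by its defining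
equations, as in `Theorems.StadiumTentNhds`) has real vertices, so by `Theorems.StadiumTentRealTrace.tent_real_trace` the tent field at `t` is the
coordinatewise complexification of the stub's own-filament real Biot–Savart integral `∫_ℝ ((‖X t − X σ‖² + κ A σ)^{3/2})⁻¹ • (X′ σ × (X t − X σ)) dσ`
(`tent_real`; the integrability of the real-source kernel at a real target, `realKernel_integrable_real`, is `Theorems.StadiumOwnReal.integrable_own_real_kernel`
pushed through the complexification).  This is the REAL-AGREEMENT CLAUSE of the own term of `rcore`.
HONEST FRAMING: bookkeeping for a HYPOTHETICAL filament skeleton on the NEGATIVE side of a MODEL route; the stub `stub_stripPropagation` is NOT closed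
by this file (the explicit BOUND and the Γ-asymptotics remain), `TangentSkeletonNearStraightL` / `SkeletonJ1L` stay OPEN; nothing here bears on
Navier–Stokes regularity or blow-up.  `--supports stmt-NavierStokesRegularity-23320` (≡ stub `stub_tangentSkeletonL` of 23296).
-/

set_option linter.dupNamespace false

noncomputable section

namespace Summit.NavierStokesRegularity.NavierStokesRegularity.Theorems.StadiumTentReal

open Set MeasureTheory Complex Finset
open scoped InnerProductSpace Matrix
open Literature.Analysis.FluidPDE
open Summit.NavierStokesRegularity.NavierStokesRegularity.Theorems.StadiumTentRealTrace
open Summit.NavierStokesRegularity.NavierStokesRegularity.Theorems.StadiumOwnReal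
open Summit.NavierStokesRegularity.NavierStokesRegularity.Theorems.StadiumPartnerReal

/-- **The complexified real-source kernel at a real target of the trace is integrable on `ℝ`** (it is the complexification of the integrable real
own-filament integrand of `Theorems.StadiumOwnReal.integrable_own_real_kernel`). [folklore] -/
theorem realKernel_integrable_real {hs L cc κ Λ : ℝ} {F : ℂ → (Fin 3 → ℂ)} {X : ℝ → EuclideanSpace ℝ (Fin 3)}
    (hFX : ∀ r : ℝ, (r : ℂ) ∈ {z : ℂ | |z.im| < hs ∧ |z.re - cc| < L + hs} →
      F r = fun i => ((⟪X r, EuclideanSpace.single i (1:ℝ)⟫_ℝ : ℝ) : ℂ))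
    (hX : ContDiff ℝ 1 X) (hXu : ∀ σ, ‖deriv X σ‖ = 1) (hosc : ∀ τ σ, ‖deriv X τ - deriv X σ‖ ≤ 1 / 2)
    {A : ℝ → ℝ} (hAc : Continuous A) (hΛ : 0 < Λ) (hA : ∀ σ, Λ⁻¹ ≤ A σ) (hκ : 0 < κ)
    (hhs : 0 < hs) {t : ℝ} (ht : |t - cc| < L + hs) :
    Integrable fun σ : ℝ => (((∑ i, (F t i - ((X σ i : ℝ) : ℂ)) ^ 2) + ((κ * A σ : ℝ) : ℂ)) ^ ((3:ℂ) / 2))⁻¹ •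
        ((fun i => ((deriv X σ i : ℝ) : ℂ)) ⨯₃ (fun i => F t i - ((X σ i : ℝ) : ℂ))) := by
  set Lc : EuclideanSpace ℝ (Fin 3) →L[ℝ] (Fin 3 → ℂ) :=
    ContinuousLinearMap.pi fun i => Complex.ofRealCLM.comp (EuclideanSpace.proj i) with hLc
  have hLc_apply : ∀ v : EuclideanSpace ℝ (Fin 3), Lc v = fun i => ((v i : ℝ) : ℂ) := by
    intro v; funext i; simp [hLc]
  have htS : ((t : ℝ) : ℂ) ∈ {z : ℂ | |z.im| < hs ∧ |z.re - cc| < L + hs} := ⟨by simpa using hhs, by simpa using ht⟩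
  have hFt : ∀ i, F t i = ((X t i : ℝ) : ℂ) := by
    intro i; rw [hFX t htS]; simp only [StadiumDeviationPackage.inner_single_eq]
  have hA0 : ∀ σ, 0 ≤ A σ := fun σ => le_trans (by positivity) (hA σ)
  have hpt : ∀ σ, (((∑ i, (F t i - ((X σ i : ℝ) : ℂ)) ^ 2) + ((κ * A σ : ℝ) : ℂ)) ^ ((3:ℂ) / 2))⁻¹ •
        ((fun i => ((deriv X σ i : ℝ) : ℂ)) ⨯₃ (fun i => F t i - ((X σ i : ℝ) : ℂ))) =
      Lc (((‖X t - X σ‖ ^ 2 + κ * A σ) ^ (3/2 : ℝ))⁻¹ • cross (deriv X σ) (X t - X σ)) := by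
    intro σ
    have h := kernel_real (X t) X hκ.le hA0 σ
    simp only [← hFt] at h
    rw [hLc_apply]
    exact h
  simp_rw [hpt]
  exact Lc.integrable_comp (integrable_own_real_kernel hX hXu hosc hAc hΛ hA hκ t)

/-- **The real trace of the symmetric tent field.**  Stadium data with real traces; kernels `f`, `g` and tent vertices `V` by their defining
equations; a real target `t` with `|t − cc| < L + hs/2`.  Then the tent field at `t` is the complexified own-filament real integral. [folklore] -/
theorem tent_real {hs L cc Λ : ℝ} {F : ℂ → (Fin 3 → ℂ)}
    (hF : DifferentiableOn ℂ F {z : ℂ | |z.im| < hs ∧ |z.re - cc| < L + hs})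
    {X : ℝ → EuclideanSpace ℝ (Fin 3)} (hX : ContDiff ℝ 1 X) (hXu : ∀ σ, ‖deriv X σ‖ = 1)
    (hosc : ∀ τ σ, ‖deriv X τ - deriv X σ‖ ≤ 1 / 2)
    (hFX : ∀ r : ℝ, (r : ℂ) ∈ {z : ℂ | |z.im| < hs ∧ |z.re - cc| < L + hs} →
      F r = fun i => ((⟪X r, EuclideanSpace.single i (1:ℝ)⟫_ℝ : ℝ) : ℂ))
    {G : ℂ → ℂ} {A : ℝ → ℝ} (hAc : Continuous A) (hΛ : 0 < Λ) (hA : ∀ σ, Λ⁻¹ ≤ A σ)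
    (hGX : ∀ r : ℝ, (r : ℂ) ∈ {z : ℂ | |z.im| < hs ∧ |z.re - cc| < L + hs} → G r = ((A r : ℝ) : ℂ))
    (hhs : 0 < hs) {κ : ℝ} (hκ : 0 < κ)
    {f : ℂ → ℂ → (Fin 3 → ℂ)}
    (hf : ∀ z ζ, f z ζ = (((∑ i, (F z i - F ζ i) ^ 2) + (κ : ℂ) * G ζ) ^ ((3:ℂ) / 2))⁻¹ •
      (deriv F ζ ⨯₃ (fun i => F z i - F ζ i)))
    {g : ℂ → ℝ → (Fin 3 → ℂ)}
    (hg : ∀ z σ, g z σ = (((∑ i, (F z i - ((X σ i : ℝ) : ℂ)) ^ 2) + ((κ * A σ : ℝ) : ℂ)) ^ ((3:ℂ) / 2))⁻¹ •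
      ((fun i => ((deriv X σ i : ℝ) : ℂ)) ⨯₃ (fun i => F z i - ((X σ i : ℝ) : ℂ))))
    {V : ℂ → ℕ → ℂ}
    (hV0 : ∀ z, V z 0 = ((z.re - hs / 2 : ℝ) : ℂ)) (hV1 : ∀ z, V z 1 = z - ((hs / 5 : ℝ) : ℂ)) (hV2 : ∀ z, V z 2 = z)
    (hV3 : ∀ z, V z 3 = z + ((hs / 5 : ℝ) : ℂ)) (hV4 : ∀ z, V z 4 = ((z.re + hs / 2 : ℝ) : ℂ))
    {t : ℝ} (ht : |t - cc| < L + hs / 2) :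
    (∫ σ in Iic (((t : ℂ)).re - hs / 2), g (t : ℂ) σ) +
        (∑ k ∈ range 4, ∫ s in (0:ℝ)..1, (V (t : ℂ) (k+1) - V (t : ℂ) k) •
          f (t : ℂ) (V (t : ℂ) k + (s : ℂ) * (V (t : ℂ) (k+1) - V (t : ℂ) k))) +
        (∫ σ in Ioi (((t : ℂ)).re + hs / 2), g (t : ℂ) σ) =
      fun i => (((∫ σ : ℝ, ((‖X t - X σ‖ ^ 2 + κ * A σ) ^ (3/2 : ℝ))⁻¹ • cross (deriv X σ) (X t - X σ)) i : ℝ) : ℂ) := by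
  -- the real vertices
  set p : ℕ → ℝ := fun k => if k = 0 then t - hs / 2 else if k = 1 then t - hs / 5 else if k = 2 then t
    else if k = 3 then t + hs / 5 else t + hs / 2 with hp
  have hVp : ∀ k ≤ 4, V (t : ℂ) k = ((p k : ℝ) : ℂ) := by
    intro k hk
    interval_cases k
    · rw [hV0]; simp [hp]
    · rw [hV1]; simp [hp]
    · rw [hV2]; simp [hp]
    · rw [hV3]; simp [hp]
    · rw [hV4]; simp [hp]
  have hp0 : p 0 = t - hs / 2 := by simp [hp]
  have hp4 : p 4 = t + hs / 2 := by simp [hp]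
  have htrace : ∀ k < 4, ∀ σ ∈ uIcc (p k) (p (k+1)), |σ - cc| < L + hs := by
    intro k hk σ hσ
    have ht' := abs_lt.mp ht
    have hpk : ∀ j ≤ 4, t - hs / 2 ≤ p j ∧ p j ≤ t + hs / 2 := by
      intro j hj
      interval_cases j <;> (refine ⟨?_, ?_⟩ <;> simp [hp] <;> linarith)
    have h1 := hpk k (by omega)
    have h2 := hpk (k+1) (by omega)
    rcases mem_uIcc.mp hσ with ⟨ha, hb⟩ | ⟨ha, hb⟩
    · rw [abs_lt]; constructor <;> linarith [h1.1, h2.2]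
    · rw [abs_lt]; constructor <;> linarith [h2.1, h1.2]
  have ht1 : |t - cc| < L + hs := by linarith [abs_nonneg (t - cc)]
  have hgi : Integrable (g (t : ℂ)) := by
    rw [funext (hg (t : ℂ))]
    exact realKernel_integrable_real hFX hX hXu hosc hAc hΛ hA hκ hhs ht1
  have key := tent_real_trace hF hX hXu hosc hFX hAc hΛ hA hGX hhs hκ hf hg (p := p) (n := 4) htrace ht1 hgi
  rw [hp0, hp4] at key
  have hsum : (∑ k ∈ range 4, ∫ s in (0:ℝ)..1, (V (t : ℂ) (k+1) - V (t : ℂ) k) •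
          f (t : ℂ) (V (t : ℂ) k + (s : ℂ) * (V (t : ℂ) (k+1) - V (t : ℂ) k))) =
      ∑ k ∈ range 4, ∫ s in (0:ℝ)..1, ((p (k+1) : ℂ) - (p k : ℂ)) •
          f (t : ℂ) ((p k : ℂ) + (s : ℂ) * ((p (k+1) : ℂ) - (p k : ℂ))) := by
    refine Finset.sum_congr rfl fun k hk => ?_
    have hk4 : k < 4 := Finset.mem_range.mp hk
    rw [hVp k hk4.le, hVp (k+1) (by omega)]
  have hre : ((t : ℂ)).re = t := Complex.ofReal_re t
  rw [hre, hsum]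
  exact key

end Summit.NavierStokesRegularity.NavierStokesRegularity.Theorems.StadiumTentReal

end
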